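import Summits.ABC.IUTFork.LDHSlotRegimePointNecessitySharp
import Summits.ABC.IUTFork.ForkGenuineWindowSharpCond
import Literature.IUT.LogVolume.Corollary22FullGaloisImage
import HarnessLib

/-!
# The fork at [IUTchIII] Corollary 3.12, L-DH level, READING (U): the SHARP necessity half, DATUM-FREE — `hvol(λ, l)` FORCES
# «((l+1)/24)·(mixed bad local height of j(λ))·(1 − tail) ≤ (4d_mod − 1 + 3d_mod/l)·(log𝔡 + log𝔣) + print's rounding/prime slack»
# (abc-iut cell, R2 S-chain team seat abc-iut-s2-p1 gen 2; crux ThetaPartII = stmt-ABC-19678; CONE binder `hvol`/`hreg`)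

Record-only PROOF file (D-0012) of the abc-iut cell; TAKES NO SIDE on [IUTchIII] Cor. 3.12 or on the (U)/(P) readings of "−|log(Θ)|".
Mochizuki, *Inter-universal Teichmüller theory IV* (RIMS manuscript Apr. 2020 = PRIMS **57** (2021)), Thm. 1.10 proof Step (ii) p. 24,
Step (v) pp. 27–28; Cor. 2.2 (ii) proof p. 46; Dupuy–Hilado [DupuyHilado2025] §3.3, §3.6, §4.7, §4.11–4.12.

Part 2 of `LDHSlotRegimePointNecessitySharp` (p445083: `hvol` ⟹ mixed share + `((l+5)/4 − d_mod)·log(𝔡^{T.K})` ≤ `B_III`, the gain still read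
on the datum's `K`). abc-iut-S4's `Cor22.ThetaVolumeDatumAt.ndeg_differentDivisor_ge` (p444868; [IUTchIV] Step (ii) first display for
`F_tpd ⊆ K` + `e(w|V) ≥ l` over the poles `V ∤ 2l` of `j(λ)`, abc-iut-w5-d009) bounds that log-different FROM BELOW by the POINT's
`log-diff(λ) + (1 − 1/l)·log𝔣^{F_tpd}`; substituting it makes the whole inequality DATUM-FREE and IUT-free. Notation (inline, no definition):
`F_mod := ℚ(j(λ)) ⊆ F_tpd`; `V` (P5)-bad iff `ord_V j(λ) < 0`, `V ∤ 2`, `V ∤ l`; `h♭(V) := (−ord_V j(λ))·log N(V)/n_V` at bad `V`, else `0`;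
`S(p) := Σ_{V|p bad} Pr(V)·h♭(V)`; `ω_p := Σ_{V|p not bad} Pr(V)`; `lD := log-diff(λ) = P.logDiff`, `lC := Cor22.logCondAvoid P {2,l}`, `d := d_mod(λ)`.

* `PointDict.pointMixedShare_le_sub_gain_of_hullVolumeAtDatum` — `Cor22.HullVolumeAtDatum P l δ` + a datum, `4d ≤ l+5` ⟹ ∀ `W` (`ω_p > 0`):
  `Σ_{p∈W} (S(p)/(2l))·(l(l+1)/12 − 4(1−ω_p)/((l−1)ω_p³)) ≤ δ − ((l+5)/4 − d)·(lD + (1 − 1/l)·lC)` — NO datum on either side;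
* **`PointDict.pointMixedShare_le_slack_of_hvol`** — from `abc_of_S_v3`'s CONE binder `hvol` VERBATIM at every admissible `(λ,l)` with `4d ≤ l+5`
  (data exist: abc-iut-L5-t7's `ThetaPartII.stub_thetaData`):
  `Σ_{p∈W} (S(p)/(2l))·(l(l+1)/12 − 4(1−ω_p)/((l−1)ω_p³)) ≤ (4d − 1 + 3d/l)·(lD + lC) + ((l+5−4d)/(4l))·lC + ((l+1)/4)·(2 log l + 52 + (20/3)·log(d*l)·π(d*l))`
  with `d* = 2¹²·3³·5·d` — the `((l+1)/4)·(1 + 12d/l)·(lD + lC)` of `B_III` is GONE from the right-hand side except for `O(d)` copies;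
* `PointDict.pointMixedShare_add_gain_le_BIII_of_hvol` — the same before simplification (`… + ((l+5)/4 − d)·(lD + (1−1/l)·lC) ≤ B_III(λ,l)`).
* `PointDict.pointMixedShare_le_slack_eventually_of_hvol` — the same with (P6) DISCHARGED: for every compactly bounded `K_V` there is
  `H_K` such that the slack inequality holds at every `λ ∈ K_V ∩ U_P` with `log(q^∀(λ)) > H_K` and every prime `l ≥ 7` with (P2), (P5),
  `4d ≤ l+5` (the tree's PROVED (P4) ⇒ (P6), `Cor22.condP6_of_seven_le`, abc-iut-S-d1); `PointDict.not_hvol_of_frequently_highMixedPoint` —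
  the contrapositive: what a kernel `¬hvol` needs is ONE `K_V` carrying such violating points above every height (no Galois-image condition).

READING (for the planners; numbers, not a side). This seat's gen-0 necessity (p438393) had the full `B_III = ((l+1)/4)·((1+12d/l)(lD+lC) + …)` on the
right: a Szpiro-type condition of ratio `≈ 6(1+12d/l)` on the mixed share. With abc-iut-w6-d018/S4's realised different gain the ratio of the
`(lD+lC)`-term drops to `≈ 24(4d−1)/(l+1) → 0`: for `l ≫ d` the (U)-line binder demands that the WHOLE `Pr`-weighted bad height of `j(λ)` at the
mixed primes be `≲ 6(4d−1+3d/l)·(24/(l+1))^{0}`… precisely `Σ_{p∈W} S(p)(1 − tail_p) ≤ (24/(l+1))·((4d−1+3d/l)(lD+lC) + ((l+5−4d)/(4l))lC) + 6(2 log l + 52) +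
40·log(d*l)·π(d*l)` — against the SUFFICIENCY half of gen 0 (`hullVolumeAtDatum_BIII_of_pointMixedHeight_le_szpiroMax`, p438083:
`((l+1)/24)Σ_{mixed}S(p) ≤ ((l+1)/4)((4(d−1)/l)(lD+lC) + prime slack)` ⟹ `hvol`) the two sides now agree in the order of the conductor term
(`O(d)` copies, both) and differ by `≈ 3d·(lD+lC)` plus the distinguished-prime band. What a kernel `¬hvol` would still need is ONE admissible
point above the necessity threshold with (P2)/(P6) certified — not attempted here. HONEST SCOPE: compositions and real arithmetic; no datum
constructed; nothing asserted about any point; no side taken on Cor. 3.12 / Thm. 1.10 or on any author; typed ≠ proved. PROOF-ONLY file: no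
definitions, no named `Prop` facts. [cite: Mochizuki2012, IUTchIV Thm. 1.10 proof Step (ii) p. 24, Step (v) p. 27–28]
[cite: Mochizuki2012, IUTchIV Cor. 2.2 (ii) proof p. 46] [cite: DupuyHilado2025, §3.3, §3.6, §4.7, §4.12] [claim: Mochizuki2012, status: disputed]
for every IUT quotation.
-/

noncomputable section

namespace Summit.ABC.IUTFork

open NumberField IsDedekindDomain Literature.IUT.LogVolume Literature.IUT.HodgeTheaters
open Literature.NumberTheory.DiophantineGeometry.GenEll Literature.NumberTheory.NumberFields
open scoped Classical

namespace PointDict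

variable {P : NFPoint} {l : ℕ}

/-- Real arithmetic of the slack: `δ = ((l+1)/4)·((1+12d/l)(lD+lC) + R)`, `lD + (1−1/l)·lC ≤ G`, `4d ≤ l+5` and `x + ((l+5)/4 − d)·G ≤ δ` give
`x ≤ (4d − 1 + 3d/l)(lD+lC) + ((l+5−4d)/(4l))·lC + ((l+1)/4)·R`. [folklore] -/
private theorem le_slack_of_add_gain_le {l d lD lC R δ G x : ℝ} (hl : 0 < l)
    (hδ : δ = (l + 1) / 4 * ((1 + 12 * d / l) * (lD + lC) + R))
    (hG : lD + (1 - 1 / l) * lC ≤ G) (h4d : 4 * d ≤ l + 5) (hx : x + ((l + 5) / 4 - d) * G ≤ δ) :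
    x ≤ (4 * d - 1 + 3 * d / l) * (lD + lC) + (l + 5 - 4 * d) / (4 * l) * lC + (l + 1) / 4 * R := by
  have hc : 0 ≤ (l + 5) / 4 - d := by linarith
  have h1 : ((l + 5) / 4 - d) * (lD + (1 - 1 / l) * lC) ≤ ((l + 5) / 4 - d) * G := mul_le_mul_of_nonneg_left hG hc
  have key : (l + 1) / 4 * ((1 + 12 * d / l) * (lD + lC) + R) - ((l + 5) / 4 - d) * (lD + (1 - 1 / l) * lC)
      = (4 * d - 1 + 3 * d / l) * (lD + lC) + (l + 5 - 4 * d) / (4 * l) * lC + (l + 1) / 4 * R := by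
    field_simp
    ring
  linarith [key]

/-- **SHARP NECESSITY, DATUM-FREE ON BOTH SIDES.** `Cor22.HullVolumeAtDatum P l δ` and a genuine Θ-volume datum at `(P, l)` (only its
EXISTENCE is used) force, when `4·d_mod ≤ l + 5`, for every finite set `W` of primes each under a non-(P5)-bad place of `ℚ(j(λ))` of positive
weight `ω_p`: `Σ_{p∈W} (S(p)/(2l))·(l(l+1)/12 − 4(1−ω_p)/((l−1)·ω_p³)) ≤ δ − ((l+5)/4 − d_mod)·(log-diff(λ) + (1 − 1/l)·log𝔣^{F_tpd}_{∤2l})`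
(part 1's `pointMixedShare_add_mulNdeg_le_of_hullVolumeAtDatum` + abc-iut-S4's `Cor22.ThetaVolumeDatumAt.ndeg_differentDivisor_ge`).
[cite: Mochizuki2012, IUTchIV Thm. 1.10 proof Step (ii) p. 24, Step (v) p. 27–28] [claim: Mochizuki2012, status: disputed] -/
theorem pointMixedShare_le_sub_gain_of_hullVolumeAtDatum {δ : ℝ} (h : Cor22.HullVolumeAtDatum P l δ)
    (T : Cor22.ThetaVolumeDatumAt P l) (hl : 0 < l) (h4d : 4 * (Cor22.dmod P : ℝ) ≤ (l : ℝ) + 5)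
    (W : Finset ℕ) (hW : ∀ p ∈ W, p.Prime)
    (hω : ∀ p ∈ W, 0 < ∑ V ∈ Finset.univ.filter
        (fun V : placesOver ↥(IntermediateField.adjoin ℚ ({Cor22.jInv P.x} : Set P.F)) p =>
          ¬ (ord _ V.1 (Cor22.jMod P) < 0 ∧ ((2 : ℕ) : 𝓞 _) ∉ V.1.asIdeal ∧ ((l : ℕ) : 𝓞 _) ∉ V.1.asIdeal)),
        weight _ V.1) :
    ∑ p ∈ W, (1 / (2 * (l : ℝ)) * ∑ V : placesOver ↥(IntermediateField.adjoin ℚ ({Cor22.jInv P.x} : Set P.F)) p,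
        (if ord _ V.1 (Cor22.jMod P) < 0 ∧ ((2 : ℕ) : 𝓞 _) ∉ V.1.asIdeal ∧ ((l : ℕ) : 𝓞 _) ∉ V.1.asIdeal then
          weight _ V.1 * (((-ord _ V.1 (Cor22.jMod P) : ℤ) : ℝ) * logNorm _ V.1 / (localDegree _ V.1 : ℝ))
         else 0)) *
      ((l : ℝ) * ((l : ℝ) + 1) / 12
        - 4 * (1 - ∑ V ∈ Finset.univ.filter
              (fun V : placesOver ↥(IntermediateField.adjoin ℚ ({Cor22.jInv P.x} : Set P.F)) p =>
                ¬ (ord _ V.1 (Cor22.jMod P) < 0 ∧ ((2 : ℕ) : 𝓞 _) ∉ V.1.asIdeal ∧ ((l : ℕ) : 𝓞 _) ∉ V.1.asIdeal)),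
              weight _ V.1) /
          (((l : ℝ) - 1) * (∑ V ∈ Finset.univ.filter
              (fun V : placesOver ↥(IntermediateField.adjoin ℚ ({Cor22.jInv P.x} : Set P.F)) p =>
                ¬ (ord _ V.1 (Cor22.jMod P) < 0 ∧ ((2 : ℕ) : 𝓞 _) ∉ V.1.asIdeal ∧ ((l : ℕ) : 𝓞 _) ∉ V.1.asIdeal)),
              weight _ V.1) ^ 3)) ≤
      δ - (((l : ℝ) + 5) / 4 - Cor22.dmod P) * (P.logDiff + (1 - 1 / (l : ℝ)) * Cor22.logCondAvoid P {2, l}) := by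
  have h1 := pointMixedShare_add_mulNdeg_le_of_hullVolumeAtDatum h T W hW hω
  have h2 := T.ndeg_differentDivisor_ge hl
  have hc : 0 ≤ ((l : ℝ) + 5) / 4 - (Cor22.dmod P : ℝ) := by linarith
  have h3 := mul_le_mul_of_nonneg_left h2 hc
  linarith

/-- **SHARP NECESSITY FROM THE CONE BINDER, before simplification.** From `abc_of_S_v3`'s `hvol` VERBATIM: at every admissible `(λ, l)` with
`4·d_mod ≤ l + 5` and every finite set `W` of primes each under a non-(P5)-bad place of `ℚ(j(λ))` of positive weight `ω_p`:
`Σ_{p∈W} (S(p)/(2l))·(l(l+1)/12 − 4(1−ω_p)/((l−1)·ω_p³)) + ((l+5)/4 − d_mod)·(log-diff(λ) + (1 − 1/l)·log𝔣) ≤ B_III(λ, l)` — datum-free and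
IUT-free (a datum exists by abc-iut-L5-t7's `ThetaPartII.stub_thetaData`; only its existence is used).
[cite: Mochizuki2012, IUTchIV Thm. 1.10 proof Step (ii) p. 24, Step (v) p. 27–28] [cite: Mochizuki2012, IUTchIV Cor. 2.2 (ii) proof p. 46]
[claim: Mochizuki2012, status: disputed] -/
theorem pointMixedShare_add_gain_le_BIII_of_hvol
    (hvol : ∀ P₀ : NFPoint, P₀ ∈ UP → ∀ l : ℕ, l.Prime → 5 ≤ l →
      Cor22.AdmitsCore P₀ → Cor22.CondP2 P₀ l → Cor22.CondP5 P₀ l → Cor22.CondP6 P₀ l →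
        Cor22.HullVolumeAtDatum P₀ l (((l : ℝ) + 1) / 4 *
          ((1 + 12 * (Cor22.dmod P₀ : ℝ) / l) * (P₀.logDiff + Cor22.logCondAvoid P₀ {2, l})
            + 2 * Real.log l + 52
            + 20 / 3 * Real.log (((2 ^ 12 * 3 ^ 3 * 5 * Cor22.dmod P₀ : ℕ) : ℝ) * (l : ℝ))
              * (Nat.primeCounting (2 ^ 12 * 3 ^ 3 * 5 * Cor22.dmod P₀ * l) : ℝ))))
    (hP : P ∈ UP) (hl : l.Prime) (h5 : 5 ≤ l) (hcore : Cor22.AdmitsCore P) (h2 : Cor22.CondP2 P l)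
    (h5' : Cor22.CondP5 P l) (h6 : Cor22.CondP6 P l) (h4d : 4 * (Cor22.dmod P : ℝ) ≤ (l : ℝ) + 5)
    (W : Finset ℕ) (hW : ∀ p ∈ W, p.Prime)
    (hω : ∀ p ∈ W, 0 < ∑ V ∈ Finset.univ.filter
        (fun V : placesOver ↥(IntermediateField.adjoin ℚ ({Cor22.jInv P.x} : Set P.F)) p =>
          ¬ (ord _ V.1 (Cor22.jMod P) < 0 ∧ ((2 : ℕ) : 𝓞 _) ∉ V.1.asIdeal ∧ ((l : ℕ) : 𝓞 _) ∉ V.1.asIdeal)),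
        weight _ V.1) :
    ∑ p ∈ W, (1 / (2 * (l : ℝ)) * ∑ V : placesOver ↥(IntermediateField.adjoin ℚ ({Cor22.jInv P.x} : Set P.F)) p,
        (if ord _ V.1 (Cor22.jMod P) < 0 ∧ ((2 : ℕ) : 𝓞 _) ∉ V.1.asIdeal ∧ ((l : ℕ) : 𝓞 _) ∉ V.1.asIdeal then
          weight _ V.1 * (((-ord _ V.1 (Cor22.jMod P) : ℤ) : ℝ) * logNorm _ V.1 / (localDegree _ V.1 : ℝ))
         else 0)) *
      ((l : ℝ) * ((l : ℝ) + 1) / 12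
        - 4 * (1 - ∑ V ∈ Finset.univ.filter
              (fun V : placesOver ↥(IntermediateField.adjoin ℚ ({Cor22.jInv P.x} : Set P.F)) p =>
                ¬ (ord _ V.1 (Cor22.jMod P) < 0 ∧ ((2 : ℕ) : 𝓞 _) ∉ V.1.asIdeal ∧ ((l : ℕ) : 𝓞 _) ∉ V.1.asIdeal)),
              weight _ V.1) /
          (((l : ℝ) - 1) * (∑ V ∈ Finset.univ.filter
              (fun V : placesOver ↥(IntermediateField.adjoin ℚ ({Cor22.jInv P.x} : Set P.F)) p =>
                ¬ (ord _ V.1 (Cor22.jMod P) < 0 ∧ ((2 : ℕ) : 𝓞 _) ∉ V.1.asIdeal ∧ ((l : ℕ) : 𝓞 _) ∉ V.1.asIdeal)),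
              weight _ V.1) ^ 3))
      + (((l : ℝ) + 5) / 4 - Cor22.dmod P) * (P.logDiff + (1 - 1 / (l : ℝ)) * Cor22.logCondAvoid P {2, l}) ≤
      ((l : ℝ) + 1) / 4 * ((1 + 12 * (Cor22.dmod P : ℝ) / l) * (P.logDiff + Cor22.logCondAvoid P {2, l})
        + 2 * Real.log l + 52 + 20 / 3 * Real.log (((2 ^ 12 * 3 ^ 3 * 5 * Cor22.dmod P : ℕ) : ℝ) * (l : ℝ))
          * (Nat.primeCounting (2 ^ 12 * 3 ^ 3 * 5 * Cor22.dmod P * l) : ℝ)) := by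
  obtain ⟨T⟩ := Summit.ABC.ABC.Theorems.ThetaPartII.stub_thetaData P hP l hl h5 hcore h2 h5' h6
  have h := pointMixedShare_le_sub_gain_of_hullVolumeAtDatum (hvol P hP l hl h5 hcore h2 h5' h6) T
    (Nat.cast_pos.mpr hl.pos) h4d W hW hω
  linarith

/-- **SHARP NECESSITY FROM THE CONE BINDER, SLACK FORM.** From `abc_of_S_v3`'s `hvol` VERBATIM: at every admissible `(λ, l)` with
`4·d_mod ≤ l + 5` and every finite set `W` of primes each under a non-(P5)-bad place of `ℚ(j(λ))` of positive weight `ω_p`: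
`Σ_{p∈W} (S(p)/(2l))·(l(l+1)/12 − 4(1−ω_p)/((l−1)·ω_p³)) ≤ (4d − 1 + 3d/l)·(lD + lC) + ((l+5−4d)/(4l))·lC + ((l+1)/4)·(2 log l + 52 + (20/3)·log(d*l)·π(d*l))`
(`d = d_mod(λ)`, `d* = 2¹²·3³·5·d`, `lD = log-diff(λ)`, `lC = log𝔣^{F_tpd}_{∤2l}`): the WHOLE `Pr`-weighted bad local height of `j(λ)` at the
mixed primes, up to the (Ind1)-tail, against `O(d_mod)` conductors and print's rounding / prime-count slack — the `((l+1)/4)·(lD+lC)` of `B_III`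
being spent on the datum's own log-different ([IUTchIV] Prop. 1.1 read backwards, abc-iut-w6-d018/S4). Datum-free, IUT-free; nothing asserted
about any point. [cite: Mochizuki2012, IUTchIV Thm. 1.10 proof Step (ii) p. 24, Step (v) p. 27–28] [cite: Mochizuki2012, IUTchIV Prop. 1.1 p. 9]
[cite: Mochizuki2012, IUTchIV Cor. 2.2 (ii) proof p. 46] [claim: Mochizuki2012, status: disputed] -/
theorem pointMixedShare_le_slack_of_hvol
    (hvol : ∀ P₀ : NFPoint, P₀ ∈ UP → ∀ l : ℕ, l.Prime → 5 ≤ l →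
      Cor22.AdmitsCore P₀ → Cor22.CondP2 P₀ l → Cor22.CondP5 P₀ l → Cor22.CondP6 P₀ l →
        Cor22.HullVolumeAtDatum P₀ l (((l : ℝ) + 1) / 4 *
          ((1 + 12 * (Cor22.dmod P₀ : ℝ) / l) * (P₀.logDiff + Cor22.logCondAvoid P₀ {2, l})
            + 2 * Real.log l + 52
            + 20 / 3 * Real.log (((2 ^ 12 * 3 ^ 3 * 5 * Cor22.dmod P₀ : ℕ) : ℝ) * (l : ℝ))
              * (Nat.primeCounting (2 ^ 12 * 3 ^ 3 * 5 * Cor22.dmod P₀ * l) : ℝ))))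
    (hP : P ∈ UP) (hl : l.Prime) (h5 : 5 ≤ l) (hcore : Cor22.AdmitsCore P) (h2 : Cor22.CondP2 P l)
    (h5' : Cor22.CondP5 P l) (h6 : Cor22.CondP6 P l) (h4d : 4 * (Cor22.dmod P : ℝ) ≤ (l : ℝ) + 5)
    (W : Finset ℕ) (hW : ∀ p ∈ W, p.Prime)
    (hω : ∀ p ∈ W, 0 < ∑ V ∈ Finset.univ.filter
        (fun V : placesOver ↥(IntermediateField.adjoin ℚ ({Cor22.jInv P.x} : Set P.F)) p =>
          ¬ (ord _ V.1 (Cor22.jMod P) < 0 ∧ ((2 : ℕ) : 𝓞 _) ∉ V.1.asIdeal ∧ ((l : ℕ) : 𝓞 _) ∉ V.1.asIdeal)),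
        weight _ V.1) :
    ∑ p ∈ W, (1 / (2 * (l : ℝ)) * ∑ V : placesOver ↥(IntermediateField.adjoin ℚ ({Cor22.jInv P.x} : Set P.F)) p,
        (if ord _ V.1 (Cor22.jMod P) < 0 ∧ ((2 : ℕ) : 𝓞 _) ∉ V.1.asIdeal ∧ ((l : ℕ) : 𝓞 _) ∉ V.1.asIdeal then
          weight _ V.1 * (((-ord _ V.1 (Cor22.jMod P) : ℤ) : ℝ) * logNorm _ V.1 / (localDegree _ V.1 : ℝ))
         else 0)) *
      ((l : ℝ) * ((l : ℝ) + 1) / 12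
        - 4 * (1 - ∑ V ∈ Finset.univ.filter
              (fun V : placesOver ↥(IntermediateField.adjoin ℚ ({Cor22.jInv P.x} : Set P.F)) p =>
                ¬ (ord _ V.1 (Cor22.jMod P) < 0 ∧ ((2 : ℕ) : 𝓞 _) ∉ V.1.asIdeal ∧ ((l : ℕ) : 𝓞 _) ∉ V.1.asIdeal)),
              weight _ V.1) /
          (((l : ℝ) - 1) * (∑ V ∈ Finset.univ.filter
              (fun V : placesOver ↥(IntermediateField.adjoin ℚ ({Cor22.jInv P.x} : Set P.F)) p =>
                ¬ (ord _ V.1 (Cor22.jMod P) < 0 ∧ ((2 : ℕ) : 𝓞 _) ∉ V.1.asIdeal ∧ ((l : ℕ) : 𝓞 _) ∉ V.1.asIdeal)),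
              weight _ V.1) ^ 3)) ≤
      (4 * (Cor22.dmod P : ℝ) - 1 + 3 * (Cor22.dmod P : ℝ) / l) * (P.logDiff + Cor22.logCondAvoid P {2, l})
        + ((l : ℝ) + 5 - 4 * (Cor22.dmod P : ℝ)) / (4 * (l : ℝ)) * Cor22.logCondAvoid P {2, l}
        + ((l : ℝ) + 1) / 4 * (2 * Real.log l + 52 + 20 / 3 * Real.log (((2 ^ 12 * 3 ^ 3 * 5 * Cor22.dmod P : ℕ) : ℝ) * (l : ℝ))
          * (Nat.primeCounting (2 ^ 12 * 3 ^ 3 * 5 * Cor22.dmod P * l) : ℝ)) := by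
  obtain ⟨T⟩ := Summit.ABC.ABC.Theorems.ThetaPartII.stub_thetaData P hP l hl h5 hcore h2 h5' h6
  have hl0 : (0 : ℝ) < (l : ℝ) := Nat.cast_pos.mpr hl.pos
  have h := pointMixedShare_add_mulNdeg_le_of_hullVolumeAtDatum (hvol P hP l hl h5 hcore h2 h5' h6) T W hW hω
  have hG := T.ndeg_differentDivisor_ge hl.pos
  exact le_slack_of_add_gain_le hl0 (by ring) hG h4d h

/-! ## (P6) removed: above some height on every compactly bounded set ([IUTchIV] Cor. 2.2 (ii) proof, (P4) ⇒ (P6)) -/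

/-- **SHARP NECESSITY WITHOUT THE GALOIS-IMAGE CONDITION.** From `abc_of_S_v3`'s CONE binder `hvol` VERBATIM: for every compactly bounded
subset `K_V` of the `λ`-line (`CBData`) there is a height `H_K` such that for every `λ ∈ K_V ∩ U_P` (minimally presented), every prime
`l ≥ 7` with (P2), (P5), `4·d_mod ≤ l + 5`, «admits an `F`-core», and `H_K < log(q^∀(λ))`, and every finite set `W` of primes each under a
non-(P5)-bad place of `ℚ(j(λ))` of positive weight `ω_p`:
`Σ_{p∈W} (S(p)/(2l))·(l(l+1)/12 − 4(1−ω_p)/((l−1)·ω_p³)) ≤ (4d − 1 + 3d/l)·(lD + lC) + ((l+5−4d)/(4l))·lC + ((l+1)/4)·(2 log l + 52 + (20/3)·log(d*l)·π(d*l))`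
— (P6) is DISCHARGED by the tree's PROVED (P4) ⇒ (P6) `Cor22.condP6_of_seven_le` (abc-iut-S-d1; [GenEll] Lem. 3.5 / Prop. 3.4 / Lem. 3.1 (iii)),
so what the (U)-line binder demands above height `H_K` is an inequality in the ELEMENTARY arithmetic of `λ` (orders of `j(λ)` at the places of
`ℚ(j(λ))`, the log-different and log-conductor of `F_tpd = ℚ(λ)`) plus the divisibility condition (P2). Nothing asserted about any point; no
side taken. [cite: Mochizuki2012, IUTchIV Cor. 2.2 (ii) proof (P4)–(P6) p. 45–46] [cite: Mochizuki2012, IUTchIV Thm. 1.10 proof Step (v) p. 27–28]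
[claim: Mochizuki2012, status: disputed] -/
theorem pointMixedShare_le_slack_eventually_of_hvol
    (hvol : ∀ P₀ : NFPoint, P₀ ∈ UP → ∀ l : ℕ, l.Prime → 5 ≤ l →
      Cor22.AdmitsCore P₀ → Cor22.CondP2 P₀ l → Cor22.CondP5 P₀ l → Cor22.CondP6 P₀ l →
        Cor22.HullVolumeAtDatum P₀ l (((l : ℝ) + 1) / 4 *
          ((1 + 12 * (Cor22.dmod P₀ : ℝ) / l) * (P₀.logDiff + Cor22.logCondAvoid P₀ {2, l})
            + 2 * Real.log l + 52
            + 20 / 3 * Real.log (((2 ^ 12 * 3 ^ 3 * 5 * Cor22.dmod P₀ : ℕ) : ℝ) * (l : ℝ))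
              * (Nat.primeCounting (2 ^ 12 * 3 ^ 3 * 5 * Cor22.dmod P₀ * l) : ℝ))))
    (D : CBData) :
    ∃ HK : ℝ, ∀ P : NFPoint, P ∈ D.toSet → P ∈ UP → ∀ l : ℕ, l.Prime → 7 ≤ l →
      Cor22.AdmitsCore P → Cor22.CondP2 P l → Cor22.CondP5 P l → 4 * (Cor22.dmod P : ℝ) ≤ (l : ℝ) + 5 →
      HK < Cor22.logQForall P →
      ∀ W : Finset ℕ, (∀ p ∈ W, p.Prime) →
        (∀ p ∈ W, 0 < ∑ V ∈ Finset.univ.filter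
          (fun V : placesOver ↥(IntermediateField.adjoin ℚ ({Cor22.jInv P.x} : Set P.F)) p =>
            ¬ (ord _ V.1 (Cor22.jMod P) < 0 ∧ ((2 : ℕ) : 𝓞 _) ∉ V.1.asIdeal ∧ ((l : ℕ) : 𝓞 _) ∉ V.1.asIdeal)),
          weight _ V.1) →
      ∑ p ∈ W, (1 / (2 * (l : ℝ)) * ∑ V : placesOver ↥(IntermediateField.adjoin ℚ ({Cor22.jInv P.x} : Set P.F)) p,
          (if ord _ V.1 (Cor22.jMod P) < 0 ∧ ((2 : ℕ) : 𝓞 _) ∉ V.1.asIdeal ∧ ((l : ℕ) : 𝓞 _) ∉ V.1.asIdeal then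
            weight _ V.1 * (((-ord _ V.1 (Cor22.jMod P) : ℤ) : ℝ) * logNorm _ V.1 / (localDegree _ V.1 : ℝ))
           else 0)) *
        ((l : ℝ) * ((l : ℝ) + 1) / 12
          - 4 * (1 - ∑ V ∈ Finset.univ.filter
                (fun V : placesOver ↥(IntermediateField.adjoin ℚ ({Cor22.jInv P.x} : Set P.F)) p =>
                  ¬ (ord _ V.1 (Cor22.jMod P) < 0 ∧ ((2 : ℕ) : 𝓞 _) ∉ V.1.asIdeal ∧ ((l : ℕ) : 𝓞 _) ∉ V.1.asIdeal)),
                weight _ V.1) /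
            (((l : ℝ) - 1) * (∑ V ∈ Finset.univ.filter
                (fun V : placesOver ↥(IntermediateField.adjoin ℚ ({Cor22.jInv P.x} : Set P.F)) p =>
                  ¬ (ord _ V.1 (Cor22.jMod P) < 0 ∧ ((2 : ℕ) : 𝓞 _) ∉ V.1.asIdeal ∧ ((l : ℕ) : 𝓞 _) ∉ V.1.asIdeal)),
                weight _ V.1) ^ 3)) ≤
        (4 * (Cor22.dmod P : ℝ) - 1 + 3 * (Cor22.dmod P : ℝ) / l) * (P.logDiff + Cor22.logCondAvoid P {2, l})
          + ((l : ℝ) + 5 - 4 * (Cor22.dmod P : ℝ)) / (4 * (l : ℝ)) * Cor22.logCondAvoid P {2, l}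
          + ((l : ℝ) + 1) / 4 * (2 * Real.log l + 52 + 20 / 3 * Real.log (((2 ^ 12 * 3 ^ 3 * 5 * Cor22.dmod P : ℕ) : ℝ) * (l : ℝ))
            * (Nat.primeCounting (2 ^ 12 * 3 ^ 3 * 5 * Cor22.dmod P * l) : ℝ)) := by
  obtain ⟨HK, hHK⟩ := Cor22.condP6_of_seven_le D
  refine ⟨HK, fun P hPD hP l hl h7 hcore h2 h5' h4d hh W hW hω => ?_⟩
  have h5 : 5 ≤ l := le_trans (by norm_num) h7
  have h6 : Cor22.CondP6 P l := hHK P hPD hP l hl h7 h2 h5' hh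
  exact pointMixedShare_le_slack_of_hvol hvol hP hl h5 hcore h2 h5' h6 h4d W hW hω

/-- **What a kernel refutation of the (U)-line CONE binder now needs** (the contrapositive, recorded for the planners; `negative-modulo`
shape): `hvol` is FALSE as soon as ONE compactly bounded `K_V` carries, above EVERY height, a point `λ ∈ K_V ∩ U_P` with a prime `l ≥ 7`
satisfying (P2), (P5), `4·d_mod ≤ l+5`, «admits a core», and a finite set `W` of primes under non-bad places of positive weight at which the
mixed-height sum EXCEEDS the slack `(4d − 1 + 3d/l)(lD+lC) + ((l+5−4d)/(4l))·lC + ((l+1)/4)(2 log l + 52 + (20/3)·log(d*l)·π(d*l))`. No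
Galois-image condition occurs. No such family is constructed here ((P2) at points of log-height `≳ 10⁸·d·l` is not certifiable in the
tree); nothing asserted about any point; no side taken. [cite: Mochizuki2012, IUTchIV Cor. 2.2 (ii) proof (P4)–(P6) p. 45–46]
[claim: Mochizuki2012, status: disputed] -/
theorem not_hvol_of_frequently_highMixedPoint (D : CBData)
    (hfam : ∀ HK : ℝ, ∃ P : NFPoint, P ∈ D.toSet ∧ P ∈ UP ∧ ∃ l : ℕ, l.Prime ∧ 7 ≤ l ∧
      Cor22.AdmitsCore P ∧ Cor22.CondP2 P l ∧ Cor22.CondP5 P l ∧ 4 * (Cor22.dmod P : ℝ) ≤ (l : ℝ) + 5 ∧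
      HK < Cor22.logQForall P ∧
      ∃ W : Finset ℕ, (∀ p ∈ W, p.Prime) ∧
        (∀ p ∈ W, 0 < ∑ V ∈ Finset.univ.filter
          (fun V : placesOver ↥(IntermediateField.adjoin ℚ ({Cor22.jInv P.x} : Set P.F)) p =>
            ¬ (ord _ V.1 (Cor22.jMod P) < 0 ∧ ((2 : ℕ) : 𝓞 _) ∉ V.1.asIdeal ∧ ((l : ℕ) : 𝓞 _) ∉ V.1.asIdeal)),
          weight _ V.1) ∧
        (4 * (Cor22.dmod P : ℝ) - 1 + 3 * (Cor22.dmod P : ℝ) / l) * (P.logDiff + Cor22.logCondAvoid P {2, l})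
          + ((l : ℝ) + 5 - 4 * (Cor22.dmod P : ℝ)) / (4 * (l : ℝ)) * Cor22.logCondAvoid P {2, l}
          + ((l : ℝ) + 1) / 4 * (2 * Real.log l + 52 + 20 / 3 * Real.log (((2 ^ 12 * 3 ^ 3 * 5 * Cor22.dmod P : ℕ) : ℝ) * (l : ℝ))
            * (Nat.primeCounting (2 ^ 12 * 3 ^ 3 * 5 * Cor22.dmod P * l) : ℝ)) <
        ∑ p ∈ W, (1 / (2 * (l : ℝ)) * ∑ V : placesOver ↥(IntermediateField.adjoin ℚ ({Cor22.jInv P.x} : Set P.F)) p,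
            (if ord _ V.1 (Cor22.jMod P) < 0 ∧ ((2 : ℕ) : 𝓞 _) ∉ V.1.asIdeal ∧ ((l : ℕ) : 𝓞 _) ∉ V.1.asIdeal then
              weight _ V.1 * (((-ord _ V.1 (Cor22.jMod P) : ℤ) : ℝ) * logNorm _ V.1 / (localDegree _ V.1 : ℝ))
             else 0)) *
          ((l : ℝ) * ((l : ℝ) + 1) / 12
            - 4 * (1 - ∑ V ∈ Finset.univ.filter
                  (fun V : placesOver ↥(IntermediateField.adjoin ℚ ({Cor22.jInv P.x} : Set P.F)) p =>
                    ¬ (ord _ V.1 (Cor22.jMod P) < 0 ∧ ((2 : ℕ) : 𝓞 _) ∉ V.1.asIdeal ∧ ((l : ℕ) : 𝓞 _) ∉ V.1.asIdeal)),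
                  weight _ V.1) /
              (((l : ℝ) - 1) * (∑ V ∈ Finset.univ.filter
                  (fun V : placesOver ↥(IntermediateField.adjoin ℚ ({Cor22.jInv P.x} : Set P.F)) p =>
                    ¬ (ord _ V.1 (Cor22.jMod P) < 0 ∧ ((2 : ℕ) : 𝓞 _) ∉ V.1.asIdeal ∧ ((l : ℕ) : 𝓞 _) ∉ V.1.asIdeal)),
                  weight _ V.1) ^ 3))) :
    ¬ (∀ P₀ : NFPoint, P₀ ∈ UP → ∀ l : ℕ, l.Prime → 5 ≤ l →
      Cor22.AdmitsCore P₀ → Cor22.CondP2 P₀ l → Cor22.CondP5 P₀ l → Cor22.CondP6 P₀ l →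
        Cor22.HullVolumeAtDatum P₀ l (((l : ℝ) + 1) / 4 *
          ((1 + 12 * (Cor22.dmod P₀ : ℝ) / l) * (P₀.logDiff + Cor22.logCondAvoid P₀ {2, l})
            + 2 * Real.log l + 52
            + 20 / 3 * Real.log (((2 ^ 12 * 3 ^ 3 * 5 * Cor22.dmod P₀ : ℕ) : ℝ) * (l : ℝ))
              * (Nat.primeCounting (2 ^ 12 * 3 ^ 3 * 5 * Cor22.dmod P₀ * l) : ℝ)))) := by
  intro hvol
  obtain ⟨HK, hHK⟩ := pointMixedShare_le_slack_eventually_of_hvol hvol D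
  obtain ⟨P, hPD, hP, l, hl, h7, hcore, h2, h5', h4d, hh, W, hW, hω, hlt⟩ := hfam HK
  exact absurd (hHK P hPD hP l hl h7 hcore h2 h5' h4d hh W hW hω) (not_le.mpr hlt)

end PointDict

end Summit.ABC.IUTFork

end
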